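import Literature.Topology.CoveringSpaces.UniversalCover
import Mathlib.Topology.Homotopy.Lifting
import Literature.AlgebraicTopology.FundamentalGroup.VanKampenKernel
import HarnessLib

/-!
# The universal cover: explicit path lifting, path connectedness, simple connectivity

Topic `Literature/Topology/CoveringSpaces`.  Continuation of `UniversalCover.lean` (A. Hatcher,
*Algebraic Topology* (2002), §1.3 pp. 64–65).  For a path `γ` in `X` from `a.pt`, the map
`s ↦ [a.cls · γ|[0,s]]` is a continuous lift of `γ` to `X̃` starting at `a` (Hatcher p. 65: "a
path `γ` in `X` … lifts to the path `t ↦ [γ_t]` in `X̃`, `γ_t` the restriction of `γ` to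
`[0, t]`"); hence `X̃` is path connected, and — lifts being unique once `p` is a covering — the
class of the endpoint of ANY path in `X̃` is the class of its start times the projected path, so
`X̃` is simply connected (Hatcher p. 65: "`X̃` is simply-connected … `p_*` injective … the lift
`t ↦ [γ_t]` of a loop `γ` is a loop only if `[γ] = [x₀]`").

* `UniversalCover.lift a γ : I → X̃`, `s ↦ ⟨γ s, a.cls · [γ|[0,s]]⟩`; `lift_zero`, `lift_one`,
  `proj_lift`, `continuous_lift`; bundled as the path `liftPath a γ` from `a` to
  `⟨y, a.cls · [γ]⟩`.
* `pathConnectedSpace` — `X̃` is path connected (for every `X`: each `[γ] ∈ X̃` is the endpoint of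
  the lift of `γ` from the base point).
* `cls_eq_of_path` — for `X` path connected and strongly locally contractible (so that `p` is a
  covering, `isCoveringMap_proj`): for every path `Λ` in `X̃` from `a` to `b`,
  `b.cls = a.cls · [p ∘ Λ]`.
* **`simplyConnectedSpace`** — `X̃` is simply connected (Hatcher 2002, §1.3 p. 65 / Cor. of
  Prop. 1.31).

All proofs are elementary; the only homotopies needed are between reparametrisations of `γ`,
obtained by mapping homotopies of paths in the simply connected interval `I`.

## References

* A. Hatcher, *Algebraic Topology*, CUP 2002, §1.3 pp. 64–65, Prop. 1.31. [HatcherAT2002]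
-/

noncomputable section

open Set Filter Topology TopologicalSpace unitInterval

namespace Literature.Topology.CoveringSpaces

universe u

variable {X : Type u} [TopologicalSpace X] {x₀ : X}

/-! ### Affine paths in the interval and initial segments of a path -/

namespace UniversalCover

/-- The affine path `t ↦ (1 - t) a + t b` in the unit interval from `a` to `b`. [folklore] -/
def seg (a b : I) : Path a b where
  toFun t := ⟨(1 - (t : ℝ)) * a + (t : ℝ) * b, by
    constructor
    · nlinarith [unitInterval.nonneg t, unitInterval.le_one t, unitInterval.nonneg a,
        unitInterval.nonneg b]
    · nlinarith [unitInterval.nonneg t, unitInterval.le_one t, unitInterval.le_one a,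
        unitInterval.le_one b, unitInterval.nonneg a, unitInterval.nonneg b]⟩
  continuous_toFun := by fun_prop
  source' := by ext; simp
  target' := by ext; simp

/-- Values of the affine path. [folklore] -/
theorem seg_apply_coe (a b t : I) : ((seg a b t : I) : ℝ) = (1 - (t : ℝ)) * a + (t : ℝ) * b := rfl

/-- The points of the affine path from `a` to `b` are within `|b - a|` of `a`. [folklore] -/
theorem dist_seg_apply_le (a b t : I) : dist (seg a b t) a ≤ dist b a := by
  rw [Subtype.dist_eq, Subtype.dist_eq, Real.dist_eq, Real.dist_eq, seg_apply_coe]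
  have h : (1 - (t : ℝ)) * a + (t : ℝ) * b - a = (t : ℝ) * (b - a) := by ring
  rw [h, abs_mul, abs_of_nonneg (unitInterval.nonneg t)]
  exact mul_le_of_le_one_left (abs_nonneg _) (unitInterval.le_one t)

/-- **Reparametrisations of a path with the same end parameters are homotopic**: for paths
`f g` in `I` from `t₀` to `t₁` and a path `γ` in `X`, `γ ∘ f ≃ γ ∘ g` rel endpoints (map a
homotopy `f ≃ g` in the simply connected interval). [folklore] -/
theorem map_homotopic_map {x y : X} (γ : Path x y) {t₀ t₁ : I} (f g : Path t₀ t₁) :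
    (f.map γ.continuous).Homotopic (g.map γ.continuous) := by
  haveI := Literature.AlgebraicTopology.FundamentalGroup.VanKampen.contractibleSpace_unitInterval
  obtain ⟨F⟩ : f.Homotopic g := SimplyConnectedSpace.paths_homotopic f g
  exact ⟨F.map (γ : C(I, X))⟩

/-- The **initial segment** `γ|[0,s]` of a path, reparametrised to `I`: `t ↦ γ (t s)`, a path from
`x` to `γ s` (Hatcher 2002, §1.3 p. 65, "`γ_t`"). [cite: HatcherAT2002, §1.3 p. 65] -/
def head {x y : X} (γ : Path x y) (s : I) : Path x (γ s) :=
  ((seg 0 s).map γ.continuous).cast γ.source.symm rfl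

/-- Values of the initial segment. [folklore] -/
theorem head_apply {x y : X} (γ : Path x y) (s t : I) : head γ s t = γ (seg 0 s t) := rfl

/-- `γ|[0,1] = γ` (up to the cast of the endpoint `γ 1 = y`). [folklore] -/
theorem head_one {x y : X} (γ : Path x y) : head γ 1 = γ.cast rfl γ.target := by
  ext t
  rw [head_apply, Path.cast_coe]
  congr 1
  ext
  simp [seg_apply_coe]

/-- `γ|[0,0]` is the constant path (up to the cast of the endpoint `γ 0 = x`). [folklore] -/
theorem head_zero {x y : X} (γ : Path x y) : head γ 0 = (Path.refl x).cast rfl γ.source := by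
  ext t
  rw [head_apply, Path.cast_coe]
  have : seg 0 0 t = 0 := by ext; simp [seg_apply_coe]
  rw [this]
  simp

/-- **`γ|[0,s] ≃ γ|[0,s₀] · γ|[s₀,s]`** rel endpoints: both are `γ` composed with paths in `I` from
`0` to `s`. [cite: HatcherAT2002, §1.3 p. 65] -/
theorem head_homotopic_trans {x y : X} (γ : Path x y) (s₀ s : I) :
    (head γ s).Homotopic ((head γ s₀).trans ((seg s₀ s).map γ.continuous)) := by
  have h := map_homotopic_map γ (seg 0 s) ((seg 0 s₀).trans (seg s₀ s))
  rw [Path.map_trans] at h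
  -- transport along the casts of the left endpoint `x = γ 0`
  obtain ⟨F⟩ := h
  exact ⟨F.cast (by ext; rfl) (by ext; rfl)⟩

/-! ### The lift of a path -/

/-- The **lift** of a path `γ` from `a.pt`, starting at `a`: `s ↦ ⟨γ s, a.cls · [γ|[0,s]]⟩`
(Hatcher 2002, §1.3 p. 65: "`t ↦ [γ_t]`"). [cite: HatcherAT2002, §1.3 p. 65] -/
def lift (a : UniversalCover X x₀) {y : X} (γ : Path a.pt y) (s : I) : UniversalCover X x₀ :=
  ⟨γ s, a.cls.trans (Path.Homotopic.Quotient.mk (head γ s))⟩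

/-- The lift lies over `γ`. [folklore] -/
@[simp] theorem proj_lift (a : UniversalCover X x₀) {y : X} (γ : Path a.pt y) (s : I) :
    proj (lift a γ s) = γ s := rfl

/-- `c · [refl].cast = c.cast` (bookkeeping of endpoint casts). [folklore] -/
theorem trans_refl_cast {z w : X} (c : Path.Homotopic.Quotient x₀ z) (h : w = z) :
    c.trans ((Path.Homotopic.Quotient.refl z).cast rfl h) = c.cast rfl h := by
  subst h
  rw [Path.Homotopic.Quotient.cast_rfl_rfl, Path.Homotopic.Quotient.cast_rfl_rfl,
    Path.Homotopic.Quotient.trans_refl]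

/-- The lift starts at `a`. [cite: HatcherAT2002, §1.3 p. 65] -/
theorem lift_zero (a : UniversalCover X x₀) {y : X} (γ : Path a.pt y) : lift a γ 0 = a := by
  obtain ⟨z, c⟩ := a
  refine mk_eq_mk γ.source ?_
  change c.trans _ = _
  rw [head_zero, Path.Homotopic.Quotient.mk_cast, Path.Homotopic.Quotient.mk_refl]
  exact trans_refl_cast c γ.source

/-- The lift ends at `⟨y, a.cls · [γ]⟩`. [cite: HatcherAT2002, §1.3 p. 65] -/
theorem lift_one (a : UniversalCover X x₀) {y : X} (γ : Path a.pt y) :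
    lift a γ 1 = ⟨y, a.cls.trans (Path.Homotopic.Quotient.mk γ)⟩ := by
  refine mk_eq_mk γ.target ?_
  rw [head_one, Path.Homotopic.Quotient.mk_cast]
  generalize γ.target = h
  revert h
  generalize γ 1 = w
  rintro rfl
  rw [Path.Homotopic.Quotient.cast_rfl_rfl, Path.Homotopic.Quotient.cast_rfl_rfl]

/-- **The lift is continuous** (Hatcher 2002, §1.3 p. 65): near `s₀`, with `γ` staying in an open
`U` around `γ s₀`, the lift stays in the tube `U_[lift s₀]` because
`[γ|[0,s]] = [γ|[0,s₀]] · [γ|[s₀,s]]` with `γ|[s₀,s]` inside `U`; and every generating tube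
containing `lift s₀` equals `U_[lift s₀]`. [cite: HatcherAT2002, §1.3 p. 65] -/
theorem continuous_lift (a : UniversalCover X x₀) {y : X} (γ : Path a.pt y) :
    Continuous (lift a γ) := by
  refine continuous_generateFrom_iff.2 ?_
  rintro _ ⟨U, b, hU, rfl⟩
  refine isOpen_iff_mem_nhds.2 fun s₀ hs₀ => ?_
  have hpt : γ s₀ ∈ U := proj_mem_of_mem_tube hs₀
  obtain ⟨ε, hε, hball⟩ := Metric.mem_nhds_iff.1
    (γ.continuous.continuousAt.preimage_mem_nhds (hU.mem_nhds hpt))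
  refine mem_of_superset (Metric.ball_mem_nhds s₀ hε) fun s hs => ?_
  change lift a γ s ∈ tube U b
  rw [← tube_eq_of_mem hs₀]
  refine ⟨(seg s₀ s).map γ.continuous, fun t => hball ?_, ?_⟩
  · exact lt_of_le_of_lt (dist_seg_apply_le s₀ s t) hs
  · show a.cls.trans (Path.Homotopic.Quotient.mk (head γ s)) =
      (a.cls.trans (Path.Homotopic.Quotient.mk (head γ s₀))).trans
        (Path.Homotopic.Quotient.mk ((seg s₀ s).map γ.continuous))
    rw [Path.Homotopic.Quotient.trans_assoc, ← Path.Homotopic.Quotient.mk_trans]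
    exact congrArg _ (Path.Homotopic.Quotient.eq.2 (head_homotopic_trans γ s₀ s))

/-- The lift of `γ` from `a`, as a path in `X̃` from `a` to `⟨y, a.cls · [γ]⟩`.
[cite: HatcherAT2002, §1.3 p. 65] -/
def liftPath (a : UniversalCover X x₀) {y : X} (γ : Path a.pt y) :
    Path a (⟨y, a.cls.trans (Path.Homotopic.Quotient.mk γ)⟩ : UniversalCover X x₀) where
  toFun := lift a γ
  continuous_toFun := continuous_lift a γ
  source' := lift_zero a γ
  target' := lift_one a γ

/-- Values of the bundled lift. [folklore] -/
theorem liftPath_apply (a : UniversalCover X x₀) {y : X} (γ : Path a.pt y) (s : I) :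
    liftPath a γ s = lift a γ s := rfl

/-! ### Path connectedness -/

/-- Every point `[γ]` of `X̃` is joined to the base point by the lift of `γ`.
[cite: HatcherAT2002, §1.3 p. 65] -/
theorem joined_base (a : UniversalCover X x₀) : Joined (base X x₀) a := by
  obtain ⟨y, c⟩ := a
  induction c using Quotient.inductionOn with
  | h γ =>
    have h := (liftPath (base X x₀) γ)
    rw [show (base X x₀).cls.trans (Path.Homotopic.Quotient.mk γ) = Path.Homotopic.Quotient.mk γ
      from Path.Homotopic.Quotient.refl_trans _] at h
    exact ⟨h⟩

/-- **The universal cover is path connected** (Hatcher 2002, §1.3 p. 65). [cite: HatcherAT2002, §1.3 p. 65] -/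
instance pathConnectedSpace : PathConnectedSpace (UniversalCover X x₀) where
  nonempty := ⟨base X x₀⟩
  joined a b := (joined_base a).symm.trans (joined_base b)

/-! ### Simple connectivity -/

/-- **Endpoint formula**: for `X` path connected and strongly locally contractible (so that `p` is
a covering map), the class of the endpoint of ANY path `Λ` in `X̃` is the class of its start
times the projected path: `b.cls = a.cls · [p ∘ Λ]` — `Λ` is the (unique) lift of `p ∘ Λ` from
`a`. [cite: HatcherAT2002, §1.3 p. 65] -/
theorem cls_eq_of_path [PathConnectedSpace X] [StronglyLocallyContractibleSpace X]
    {a b : UniversalCover X x₀} (Λ : Path a b) :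
    b.cls = a.cls.trans (Path.Homotopic.Quotient.mk (Λ.map continuous_proj)) := by
  have hΓ : (lift a (Λ.map continuous_proj) : I → UniversalCover X x₀) = Λ := by
    refine isCoveringMap_proj.eq_of_comp_eq (continuous_lift a _) Λ.continuous ?_ 0 ?_
    · funext s
      rfl
    · rw [lift_zero, Λ.source]
  have h1 := congrFun hΓ 1
  rw [lift_one, Λ.target] at h1
  -- `h1 : ⟨b.pt, a.cls · [p ∘ Λ]⟩ = b`
  obtain ⟨h, hc⟩ := ext_iff'.1 h1
  cases h
  rw [Path.Homotopic.Quotient.cast_rfl_rfl] at hc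
  exact hc.symm

/-- **The universal cover is simply connected** (Hatcher 2002, §1.3 p. 65; Prop. 1.31: `p_*` is
injective): two paths in `X̃` with the same endpoints project to homotopic paths (their classes
are both `a.cls⁻¹ · b.cls` by the endpoint formula), hence are homotopic by injectivity of the
covering on homotopy classes (Mathlib `IsCoveringMap.injective_path_homotopic_map`).
[cite: HatcherAT2002, §1.3 p. 65 and Prop. 1.31] -/
instance simplyConnectedSpace [PathConnectedSpace X] [StronglyLocallyContractibleSpace X] :
    SimplyConnectedSpace (UniversalCover X x₀) := by
  rw [simply_connected_iff_paths_homotopic]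
  refine ⟨inferInstance, fun a b => ⟨?_⟩⟩
  intro p q
  induction p using Quotient.inductionOn with
  | h p =>
  induction q using Quotient.inductionOn with
  | h q =>
  change Path.Homotopic.Quotient.mk p = Path.Homotopic.Quotient.mk q
  apply isCoveringMap_proj.injective_path_homotopic_map a b
  change (Path.Homotopic.Quotient.mk p).map ⟨proj, continuous_proj⟩ =
    (Path.Homotopic.Quotient.mk q).map ⟨proj, continuous_proj⟩
  rw [← Path.Homotopic.Quotient.mk_map, ← Path.Homotopic.Quotient.mk_map]
  have hp := cls_eq_of_path p
  have hq := cls_eq_of_path q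
  rw [hp] at hq
  -- cancel `a.cls` on the left
  have := congrArg (Path.Homotopic.Quotient.trans (Path.Homotopic.Quotient.symm a.cls)) hq
  rw [← Path.Homotopic.Quotient.trans_assoc, ← Path.Homotopic.Quotient.trans_assoc,
    Path.Homotopic.Quotient.symm_trans, Path.Homotopic.Quotient.refl_trans,
    Path.Homotopic.Quotient.refl_trans] at this
  exact this

end UniversalCover

end Literature.Topology.CoveringSpaces
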